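import Summits.CriticalPhenomena.PercolationContinuityZ3.Theorems.PercNearOneGluingNoHeavyLowerTailKNQuestion9Transport
import Summits.CriticalPhenomena.PercolationContinuityZ3.Theorems.PercNearOneGluingNoHeavyLowerTailMixCSHInduction
import HarnessLib

/-!
# Kozma–Nitzan's Question 9 for EVERY relay set on EVERY finite weighted graph, from Theorem M1 (the mixed hierarchy)

Support file (`--supports stmt-CriticalPhenomena-4575`), prover `prim-ineq-gen-7` (gen 9).  No definitions, no named facts, no sorries.
Memo `prim-ineq-gen-7/PROOF-Q9-MIXED-CSH.md` §4, §9.4; the end of the roadmap modulo Theorem M1.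

`MixCSH.kn_question9_of_M1`: IF the mixed conditioned slack hierarchy holds on every `Fin n` at all weights `< 1` (THEOREM M1 of the memo, in the
exact output shape of `MixCSH.mixCSHHolds_of_unfold` — bricks B1 ✓, B3 ✓, B4 ✓, B5-skeleton ✓ landed; B2 = the one-level unfolding in progress),
THEN for every finite vertex type `W`, weights `w` with `w e < 1` on the pairs off the observer `o` (weight `0` = absent edge; the pairs at `o` are
unrestricted), every relay set `A ∌ o`, target `b` and relay `c ∈ A` minimising `P_H(· ↔ b)` in the relay graph `H = G − E(o)` (`restrW {o}ᶜ w`):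
`P_G(c ↔ b, o ↔ A) ≤ P_G(o ↔ b, o ↔ A)` — Kozma–Nitzan, arXiv:2401.12397 §5.5 QUESTION 9, for every `|A|`
(`MixCSH.kn_question9_of_mixCSH` on `Fin n` with a spare vertex, gen 8, + `KnQ9Transport.question9_fintype_of_fin_spare`, gen 9).
[cite: KozmaNitzan2024, Question 9 (§5.5 p. 36), Conjecture 6 (§5.3 p. 34)]
-/

noncomputable section

namespace Summit.CriticalPhenomena.PercolationContinuityZ3.Theorems

open MeasureTheory Set Literature.Probability.LatticeModels Literature.Probability.Percolation
open scoped Classical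

namespace MixCSH

/-- **KOZMA–NITZAN'S QUESTION 9 FOR EVERY RELAY SET, ON EVERY FINITE WEIGHTED GRAPH, FROM THEOREM M1.**  Hypothesis `hM1`: the mixed hierarchy
`MixCSHHolds w Σ x Y D o v` on every `Fin n` at all weights `< 1`, for all data with distinct named vertices (the output shape of
`MixCSH.mixCSHHolds_of_unfold`).  Conclusion: for every finite vertex type `W`, weights `< 1` off the observer `o`, `A ∌ o`, `c ∈ A` with
`P_H(c↔b) ≤ P_H(a↔b)` (`a ∈ A`, `H = restrW {o}ᶜ w`): `P_G(c↔b ∩ o↔A) ≤ P_G(o↔b ∩ o↔A)`.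
[cite: KozmaNitzan2024, Question 9 (§5.5 p. 36)] -/
theorem kn_question9_of_M1
    (hM1 : ∀ (n : ℕ) (w : Sym2 (Fin n) → unitInterval), (∀ e, w e < 1) →
      ∀ (Sig : Set (Fin n)) (x : Fin n) (Y : Set (Fin n)) (D : List (Fin n)) (o v : Fin n),
        x ∉ Y → o ∉ insert x Y → v ∉ insert x Y → o ≠ v → D.Nodup → (∀ d ∈ D, d ∉ insert x Y ∧ d ≠ o ∧ d ≠ v) →
        MixCSHHolds w Sig x Y D o v)
    {W : Type*} [Fintype W] (w : Sym2 W → unitInterval) (o : W) (hw : ∀ e : Sym2 W, e ∈ wireSet ({o}ᶜ : Set W) → w e < 1)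
    (A : Finset W) (hoA : o ∉ A) (b c : W) (hcA : c ∈ A)
    (hmin : ∀ a ∈ A, (prodBernoulli (restrW ({o}ᶜ : Set W) w)).real (openConn c b) ≤
      (prodBernoulli (restrW ({o}ᶜ : Set W) w)).real (openConn a b)) :
    (prodBernoulli w).real (openConn c b ∩ ⋃ a ∈ A, openConn o a) ≤
      (prodBernoulli w).real (openConn o b ∩ ⋃ a ∈ A, openConn o a) := by
  refine KnQ9Transport.question9_fintype_of_fin_spare (fun n w' o' v' hov' hw' A' hoA' hvA' b' c' hcA' hmin' => ?_)
    w o hw A hoA b c hcA hmin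
  refine kn_question9_of_mixCSH w' o' v' hov' hw' (fun Sig _ x Y D hxY hox hvx hoY hvY hnd hdis => ?_) A' hoA' hvA' b' c' hcA' hmin'
  have hwH : ∀ e, restrW ({o'}ᶜ : Set (Fin n)) w' e < 1 := by
    intro e
    by_cases he : e ∈ wireSet ({o'}ᶜ : Set (Fin n))
    · rw [restrW_apply_of_mem w' he]; exact hw' e he
    · rw [restrW_apply_of_not_mem w' he]; exact zero_lt_one
  refine hM1 n _ hwH Sig x (↑Y : Set (Fin n)) D o' v' (fun h => hxY (Finset.mem_coe.1 h)) ?_ ?_ hov' hnd ?_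
  · rintro (h | h)
    · exact hox h
    · exact hoY (Finset.mem_coe.1 h)
  · rintro (h | h)
    · exact hvx h
    · exact hvY (Finset.mem_coe.1 h)
  · intro d hd
    refine ⟨?_, (hdis d hd).2.2.1, (hdis d hd).2.2.2⟩
    rintro (h | h)
    · exact (hdis d hd).1 h
    · exact (hdis d hd).2.1 (Finset.mem_coe.1 h)

end MixCSH

end Summit.CriticalPhenomena.PercolationContinuityZ3.Theorems
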